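import Summits.HodgeConjecture.HodgeConjecture.Theorems.F0P3cStCharTSOfQuasiSplit      -- ★ p847934 (this seat): §1 `isLocalDeltaTransfer_iff_of_formCongr`, §2 `stCharTS_of_quasiSplit` (+ ★ «TR» p847804)
import Literature.NumberTheory.Rogawski1990.LocalTransferExplicitNonsplit                -- ★ `LocalTransferExplicitNonsplitClosed` (= closer row `stub_N6ns`, BY NAME)
import Literature.NumberTheory.Rogawski1990.LocalTransferCompactSideJunctionCM            -- ★ `isLocalGRegular_of_isLocalStablyConjH`
import Literature.NumberTheory.Automorphic.UnitaryGroupPatchedFamiliesTransport          -- ★ `isLocalDeltaTransferExists_iff_of_eqOn_regular`, `stableOrbitalIntegralRel_congr_of_eqOn`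
import Literature.NumberTheory.Automorphic.UnitaryGroupNonsplitPlace                     -- ★ `PlacesOver.eq_of_smul_eq`
import Literature.NumberTheory.Automorphic.OrbitalMeasureCanonical                        -- ★ `OrbitalMeasureFamily.IsCanonical.eq_of_isCanonical`
import HarnessLib

/-!
# F0 · P3c · line LH6 «StCharTS» — ORGAN «QS» §3: the closer row `stub_StCharTS` (N-1273S) from `QS_T` (the quasi-split, sign-free, per-place statement WITH
# the transfer-existence hypothesis (T_v) on the model) and the closer's own row N6-ns `LocalTransferExplicitNonsplitClosed` BY NAME

Cell `pub/hodgecm-mathlib`, crux H413 = `stmt-HodgeConjecture-24833` (`--supports` lane, helper), route HCCMUnconditional; seat LH6-p01 (g0); the desk's ASK of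
2026-09-02T02:25:32Z (F0P3b-plan (g23), skeleton v2: organs re-sited on `U(Φ₃)(L⁺_v)`, `QST_of_organs : … → QS_T`, junction
`StCharTS_of_organs … (hT) := stCharTS_of_quasiSplit_of_transferExists hT (QST_of_organs …)`).  Same namespace as ★ `Theorems/F0P3cStCharTSOfQuasiSplit` (second
module of the organ, ≤ 400 lines each).  THEOREMS ONLY, sorry-free, no definition ∕ instance ∕ notation ∕ named fact.
HONEST LABEL: HC_CM is proved only modulo the 7 printed citations (2 remaining: hLiu418 = stmt-HodgeConjecture-24832, h413 = stmt-HodgeConjecture-24833)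
until rung 0 closes; count-neutral glue — (N-1273S) is only re-sited; N6-ns stays the closer's registered row.

THE MATHEMATICS.  `QS_T` = ★ `stCharTS_of_quasiSplit`'s hypothesis `QS` with ONE extra antecedent after the canonicity hypotheses: (T_v) «every `φ ∈ C_c^∞(U(Φ₃)_v)` has a
`Δ‴_{Φ₃}`-transfer `φ^H ∈ C_c^∞(H_v)` for `(m_H, m_Q)`» (★ `IsLocalDeltaTransferExists`; [Rogawski1990, §4.9 Prop. 4.9.1 (a) p. 55], used by print on pp. 191 and 194).
To discharge it at the transported data `(m_H, e⁻¹_* m_G)` of the row's frame: (1) the closer's row N6-ns gives, at the non-split `v` (one place above `v`, ★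
`PlacesOver.eq_of_smul_eq`), ITS OWN canonical families with smooth `Δ‴_H`-transfer; (2) two canonical pairs agree where (4.3.1) reads them, so the frame's `(m_H, m_G)` has
smooth transfer too (`isLocalDeltaTransferExists_of_isCanonical_pair` = the LH6 skeleton v1's glue, desk F0P3b-plan (g23), copied with attribution — a `Lines` module is not
importable here); (3) along `e`: `φ ↦ f := φ ∘ e⁻¹`, its transfer `f^H`, and `χ(a)·f^H` is a `Δ‴_{Φ₃}`-transfer of `φ` for `e⁻¹_* m_G` (★ §1 `isLocalDeltaTransfer_iff_of_formCongr`).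
Then the proof of ★ `stCharTS_of_quasiSplit` runs verbatim with `QS_T` fed the extra witness.

## References
* [Rogawski1990] J. D. Rogawski, *Automorphic Representations of Unitary Groups in Three Variables*, Ann. of Math. Stud. 123 (1990): §12.7 Lemma 12.7.3 & Cor. 12.7.4
  p. 195; §4.9 Prop. 4.9.1 (a) p. 55; §4.3 (4.3.1)–(4.3.2) p. 43; §14.4 pp. 234–237.
* [LanglandsShelstad1987] R. P. Langlands, D. Shelstad, *On the definition of transfer factors*, Math. Ann. 278 (1987), §4.2.
* [DeitmarEchterhoff2014] A. Deitmar, S. Echterhoff, *Principles of Harmonic Analysis*, 2nd ed. (2014), Thm. 1.5.3.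
-/

set_option autoImplicit false
-- the mandated namespace has the single-problem summit's repeated segment (`HodgeConjecture.HodgeConjecture`)
set_option linter.dupNamespace false

noncomputable section

open NumberField IsDedekindDomain MeasureTheory MeasureTheory.Measure
open scoped Matrix MatrixGroups
open Literature.NumberTheory.Rogawski1990 Literature.NumberTheory.Automorphic Literature.NumberTheory.Automorphic.UnitaryGroup
open Literature.NumberTheory.GaloisRepresentations

namespace Summit.HodgeConjecture.HodgeConjecture.Cruxes.H413.F0P3cStCharTSOfQuasiSplit

/-! ## §3 (T_v): from the closer's row N6-ns to the frame's families and to the model; the row from `QS_T` -/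

/-- **Prop. 4.9.1 (a) at `v` does not depend on the choice of CANONICAL measure families** (the LH6 skeleton v1's glue `isLocalDeltaTransferExists_of_isCanonical`,
desk F0P3b-plan (g23), copied with attribution so that this ★ file does not import a `Lines` module): two pairs of canonical families (`H`-side canonical on the `G`-regular
classes for `νH`, `G′`-side canonical on the regular classes for `νG`) agree where (4.3.1) reads them (★ `OrbitalMeasureFamily.IsCanonical.eq_of_isCanonical`; `G`-regularity is
a stable-class function ★ `isLocalGRegular_of_isLocalStablyConjH`; the `G′`-side is ★ `isLocalDeltaTransferExists_iff_of_eqOn_regular`), so smooth transfer for one pair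
gives smooth transfer for the other. [cite: Rogawski1990, §4.3 (4.3.1) p. 43; §4.9 Prop. 4.9.1 (a) p. 55] [cite: DeitmarEchterhoff2014, Thm. 1.5.3] -/
theorem isLocalDeltaTransferExists_of_isCanonical_pair (L : Type) [Field L] [NumberField L] [IsCMField L] (H : Matrix (Fin 3) (Fin 3) L) (v : HeightOneSpectrum (𝓞 ↥(maximalRealSubfield L)))
    [MeasurableSpace ((UnitaryGroup.cmDatum L 2 (Matrix.of fun i j : Fin 2 => if i.val + j.val + 1 = 2 then (1 : L) else 0)).Local v × (UnitaryGroup.cmDatum L 1 (Matrix.of fun i j : Fin 1 => if i.val + j.val + 1 = 1 then (1 : L) else 0)).Local v)] [BorelSpace ((UnitaryGroup.cmDatum L 2 (Matrix.of fun i j : Fin 2 => if i.val + j.val + 1 = 2 then (1 : L) else 0)).Local v × (UnitaryGroup.cmDatum L 1 (Matrix.of fun i j : Fin 1 => if i.val + j.val + 1 = 1 then (1 : L) else 0)).Local v)] [MeasurableSpace ((UnitaryGroup.cmDatum L 3 H).Local v)] [BorelSpace ((UnitaryGroup.cmDatum L 3 H).Local v)]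
    [∀ a : (UnitaryGroup.cmDatum L 2 (Matrix.of fun i j : Fin 2 => if i.val + j.val + 1 = 2 then (1 : L) else 0)).Local v × (UnitaryGroup.cmDatum L 1 (Matrix.of fun i j : Fin 1 => if i.val + j.val + 1 = 1 then (1 : L) else 0)).Local v, MeasurableSpace (((UnitaryGroup.cmDatum L 2 (Matrix.of fun i j : Fin 2 => if i.val + j.val + 1 = 2 then (1 : L) else 0)).Local v × (UnitaryGroup.cmDatum L 1 (Matrix.of fun i j : Fin 1 => if i.val + j.val + 1 = 1 then (1 : L) else 0)).Local v) ⧸ Subgroup.centralizer ({a} : Set ((UnitaryGroup.cmDatum L 2 (Matrix.of fun i j : Fin 2 => if i.val + j.val + 1 = 2 then (1 : L) else 0)).Local v × (UnitaryGroup.cmDatum L 1 (Matrix.of fun i j : Fin 1 => if i.val + j.val + 1 = 1 then (1 : L) else 0)).Local v)))] [∀ a : (UnitaryGroup.cmDatum L 2 (Matrix.of fun i j : Fin 2 => if i.val + j.val + 1 = 2 then (1 : L) else 0)).Local v × (UnitaryGroup.cmDatum L 1 (Matrix.of fun i j : Fin 1 => if i.val + j.val + 1 = 1 then (1 : L) else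 0)).Local v, BorelSpace (((UnitaryGroup.cmDatum L 2 (Matrix.of fun i j : Fin 2 => if i.val + j.val + 1 = 2 then (1 : L) else 0)).Local v × (UnitaryGroup.cmDatum L 1 (Matrix.of fun i j : Fin 1 => if i.val + j.val + 1 = 1 then (1 : L) else 0)).Local v) ⧸ Subgroup.centralizer ({a} : Set ((UnitaryGroup.cmDatum L 2 (Matrix.of fun i j : Fin 2 => if i.val + j.val + 1 = 2 then (1 : L) else 0)).Local v × (UnitaryGroup.cmDatum L 1 (Matrix.of fun i j : Fin 1 => if i.val + j.val + 1 = 1 then (1 : L) else 0)).Local v)))]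
    [∀ γ : (UnitaryGroup.cmDatum L 3 H).Local v, MeasurableSpace (((UnitaryGroup.cmDatum L 3 H).Local v) ⧸ Subgroup.centralizer ({γ} : Set ((UnitaryGroup.cmDatum L 3 H).Local v)))] [∀ γ : (UnitaryGroup.cmDatum L 3 H).Local v, BorelSpace (((UnitaryGroup.cmDatum L 3 H).Local v) ⧸ Subgroup.centralizer ({γ} : Set ((UnitaryGroup.cmDatum L 3 H).Local v)))]
    (νH : Measure ((UnitaryGroup.cmDatum L 2 (Matrix.of fun i j : Fin 2 => if i.val + j.val + 1 = 2 then (1 : L) else 0)).Local v × (UnitaryGroup.cmDatum L 1 (Matrix.of fun i j : Fin 1 => if i.val + j.val + 1 = 1 then (1 : L) else 0)).Local v)) (νG : Measure ((UnitaryGroup.cmDatum L 3 H).Local v)) [IsFiniteMeasureOnCompacts νH] [νH.IsMulRightInvariant]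
    [IsFiniteMeasureOnCompacts νG] [νG.IsMulRightInvariant]
    (Δ : LocalTransferFactor L H v) {mH mH' : OrbitalMeasureFamily ((UnitaryGroup.cmDatum L 2 (Matrix.of fun i j : Fin 2 => if i.val + j.val + 1 = 2 then (1 : L) else 0)).Local v × (UnitaryGroup.cmDatum L 1 (Matrix.of fun i j : Fin 1 => if i.val + j.val + 1 = 1 then (1 : L) else 0)).Local v)} {mG mG' : OrbitalMeasureFamily ((UnitaryGroup.cmDatum L 3 H).Local v)}
    (hH : mH.IsCanonical (IsLocalGRegular L v) νH) (hH' : mH'.IsCanonical (IsLocalGRegular L v) νH)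
    (hG : mG.IsCanonical (fun γ => IsRegularElt (γ.val : GL (Fin 3) (UnitaryGroup.LocalRing L v))) νG)
    (hG' : mG'.IsCanonical (fun γ => IsRegularElt (γ.val : GL (Fin 3) (UnitaryGroup.LocalRing L v))) νG)
    (SmG : ((UnitaryGroup.cmDatum L 3 H).Local v → ℂ) → Prop) (SmH : ((UnitaryGroup.cmDatum L 2 (Matrix.of fun i j : Fin 2 => if i.val + j.val + 1 = 2 then (1 : L) else 0)).Local v × (UnitaryGroup.cmDatum L 1 (Matrix.of fun i j : Fin 1 => if i.val + j.val + 1 = 1 then (1 : L) else 0)).Local v → ℂ) → Prop)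
    (h : IsLocalDeltaTransferExists L H v Δ mH' mG' SmG SmH) : IsLocalDeltaTransferExists L H v Δ mH mG SmG SmH := by
  have hGe : ∀ c : ConjClasses ((UnitaryGroup.cmDatum L 3 H).Local v), IsRegularElt ((Quotient.out c).val : GL (Fin 3) (UnitaryGroup.LocalRing L v)) → mG c = mG' c :=
    fun c hc => hG.eq_of_isCanonical hG' hc
  have h1 : IsLocalDeltaTransferExists L H v Δ mH' mG SmG SmH :=
    (isLocalDeltaTransferExists_iff_of_eqOn_regular L H v Δ mH' hGe SmG SmH).1 h
  intro f hf
  obtain ⟨fH, hfH, htr⟩ := h1 f hf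
  refine ⟨fH, hfH, fun a ha => ?_⟩
  rw [← htr a ha]
  exact stableOrbitalIntegralRel_congr_of_eqOn
    (fun c hc => hH.eq_of_isCanonical hH' (isLocalGRegular_of_isLocalStablyConjH L v hc ha)) fH

open scoped Classical in
/-- **(T_v) TRANSPORTED TO THE MODEL**: if every smooth `f` on `U(H)(L⁺_v)` has a smooth `Δ‴_H`-transfer for `(m_H, m_G)`, then every smooth `φ` on `U(Φ₃)(L⁺_v)` has a
smooth `Δ‴_{Φ₃}`-transfer for `(m_H, e⁻¹_* m_G)` — take `f := φ ∘ e⁻¹` (★ `isLocSmooth_comp_continuousMulEquiv`), its transfer `f^H`, and `χ(a)·f^H` (§1 `.1`).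
[cite: Rogawski1990, §4.9 Prop. 4.9.1 (a) p. 55; §14.4 p. 237] [cite: LanglandsShelstad1987, §4.2] -/
theorem isLocalDeltaTransferExists_model_of_formCongr (L : Type) [Field L] [NumberField L] [IsCMField L] (H : Matrix (Fin 3) (Fin 3) L) (μ : HeckeCharacter L)
    (v : HeightOneSpectrum (𝓞 ↥(maximalRealSubfield L))) (w : PlacesOver L v) (hw : IsCMField.complexConj L • w.1 = w.1)
    (hherm : (H.map (cmConjRingHom L))ᵀ = H) (hdet : H.det ≠ 0)
    (T : GL (Fin 3) (UnitaryGroup.LocalRing L v)) {a : UnitaryGroup.LocalRing L v} (ha : IsUnit a)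
    (haσ : conjLocal L (IsCMField.complexConj L) v a = a)
    (h : formCongr (conjLocal L (IsCMField.complexConj L) v) T (H.map (algebraMap L (UnitaryGroup.LocalRing L v))) =
      a • (Matrix.of fun i j : Fin 3 => if i.val + j.val + 1 = 3 then (1 : L) else 0).map (algebraMap L (UnitaryGroup.LocalRing L v)))
    [MeasurableSpace ((UnitaryGroup.cmDatum L 3 H).Local v)] [BorelSpace ((UnitaryGroup.cmDatum L 3 H).Local v)] [MeasurableSpace ((UnitaryGroup.cmDatum L 3 (Matrix.of fun i j : Fin 3 => if i.val + j.val + 1 = 3 then (1 : L) else 0)).Local v)] [BorelSpace ((UnitaryGroup.cmDatum L 3 (Matrix.of fun i j : Fin 3 => if i.val + j.val + 1 = 3 then (1 : L) else 0)).Local v)]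
    [∀ γ : (UnitaryGroup.cmDatum L 3 H).Local v, MeasurableSpace (((UnitaryGroup.cmDatum L 3 H).Local v) ⧸ Subgroup.centralizer ({γ} : Set ((UnitaryGroup.cmDatum L 3 H).Local v)))] [∀ γ : (UnitaryGroup.cmDatum L 3 H).Local v, BorelSpace (((UnitaryGroup.cmDatum L 3 H).Local v) ⧸ Subgroup.centralizer ({γ} : Set ((UnitaryGroup.cmDatum L 3 H).Local v)))]
    [∀ γ : (UnitaryGroup.cmDatum L 3 (Matrix.of fun i j : Fin 3 => if i.val + j.val + 1 = 3 then (1 : L) else 0)).Local v, MeasurableSpace (((UnitaryGroup.cmDatum L 3 (Matrix.of fun i j : Fin 3 => if i.val + j.val + 1 = 3 then (1 : L) else 0)).Local v) ⧸ Subgroup.centralizer ({γ} : Set ((UnitaryGroup.cmDatum L 3 (Matrix.of fun i j : Fin 3 => if i.val + j.val + 1 = 3 then (1 : L) else 0)).Local v)))] [∀ γ : (UnitaryGroup.cmDatum L 3 (Matrix.of fun i j : Fin 3 => if i.val + j.val + 1 = 3 then (1 : L) else 0)).Local v, BorelSpace (((UnitaryGroup.cmDatum L 3 (Matrix.of fun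 i j : Fin 3 => if i.val + j.val + 1 = 3 then (1 : L) else 0)).Local v) ⧸ Subgroup.centralizer ({γ} : Set ((UnitaryGroup.cmDatum L 3 (Matrix.of fun i j : Fin 3 => if i.val + j.val + 1 = 3 then (1 : L) else 0)).Local v)))]
    [∀ a' : (UnitaryGroup.cmDatum L 2 (Matrix.of fun i j : Fin 2 => if i.val + j.val + 1 = 2 then (1 : L) else 0)).Local v × (UnitaryGroup.cmDatum L 1 (Matrix.of fun i j : Fin 1 => if i.val + j.val + 1 = 1 then (1 : L) else 0)).Local v, MeasurableSpace (((UnitaryGroup.cmDatum L 2 (Matrix.of fun i j : Fin 2 => if i.val + j.val + 1 = 2 then (1 : L) else 0)).Local v × (UnitaryGroup.cmDatum L 1 (Matrix.of fun i j : Fin 1 => if i.val + j.val + 1 = 1 then (1 : L) else 0)).Local v) ⧸ Subgroup.centralizer ({a'} : Set ((UnitaryGroup.cmDatum L 2 (Matrix.of fun i j : Fin 2 => if i.val + j.val + 1 = 2 then (1 : L) else 0)).Local v × (UnitaryGroup.cmDatum L 1 (Matrix.of fun i j : Fin 1 => if i.val + j.val + 1 = 1 then (1 : L) else 0)).Lo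cal v)))]
    (mHv : OrbitalMeasureFamily ((UnitaryGroup.cmDatum L 2 (Matrix.of fun i j : Fin 2 => if i.val + j.val + 1 = 2 then (1 : L) else 0)).Local v × (UnitaryGroup.cmDatum L 1 (Matrix.of fun i j : Fin 1 => if i.val + j.val + 1 = 1 then (1 : L) else 0)).Local v)) (mGv : OrbitalMeasureFamily ((UnitaryGroup.cmDatum L 3 H).Local v))
    (hex : IsLocalDeltaTransferExists L H v ((finExplicitCollection L H μ (finExplicitDelta_conj_left_all L H μ) (finExplicitDelta_conj_right_all L H μ)) v) mHv mGv IsLocSmooth IsLocSmooth) :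
    IsLocalDeltaTransferExists L (Matrix.of fun i j : Fin 3 => if i.val + j.val + 1 = 3 then (1 : L) else 0) v ((finExplicitCollection L (Matrix.of fun i j : Fin 3 => if i.val + j.val + 1 = 3 then (1 : L) else 0) μ (finExplicitDelta_conj_left_all L (Matrix.of fun i j : Fin 3 => if i.val + j.val + 1 = 3 then (1 : L) else 0) μ) (finExplicitDelta_conj_right_all L (Matrix.of fun i j : Fin 3 => if i.val + j.val + 1 = 3 then (1 : L) else 0) μ)) v) mHv
      (mGv.transport (cmDatumLocalCongr L v T ha h).symm.toMulEquiv (cmDatumLocalCongr L v T ha h).symm.continuous (cmDatumLocalCongr L v T ha h).continuous) IsLocSmooth IsLocSmooth := by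
  intro φ hφ
  obtain ⟨fH, hfH, hm⟩ := hex (φ ∘ (cmDatumLocalCongr L v T ha h).symm) (F0P3cStCharTSTransport.isLocSmooth_comp_continuousMulEquiv (cmDatumLocalCongr L v T ha h).symm hφ)
  refine ⟨((if ∃ z : UnitaryGroup.LocalRing L v, IsUnit z ∧ a = z * UnitaryGroup.conjLocal L (IsCMField.complexConj L) v z then (1 : ℤ) else -1 : ℤ) : ℂ) • fH, ⟨hfH.1.comp fun z => ((if ∃ z : UnitaryGroup.LocalRing L v, IsUnit z ∧ a = z * UnitaryGroup.conjLocal L (IsCMField.complexConj L) v z then (1 : ℤ) else -1 : ℤ) : ℂ) * z, hfH.2.mono (Function.support_const_smul_subset _ fH)⟩, ?_⟩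
  have hφe : (φ ∘ (cmDatumLocalCongr L v T ha h).symm) ∘ (cmDatumLocalCongr L v T ha h) = φ := by
    funext q
    simp only [Function.comp_apply, ContinuousMulEquiv.symm_apply_apply]
  have h₁ := (isLocalDeltaTransfer_iff_of_formCongr L H μ v w hw hherm hdet T ha haσ h mHv mGv fH (φ ∘ (cmDatumLocalCongr L v T ha h).symm)).1 hm
  rwa [hφe] at h₁

open scoped Classical in
/-- **ORGAN «QS» WITH (T_v) — `stub_StCharTS` FROM `QS_T` (= QS with the transfer-existence hypothesis (T_v) on the model inserted after the canonicity hypotheses,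
the desk's `QST.v2` text VERBATIM) AND THE CLOSER'S ROW N6-ns `LocalTransferExplicitNonsplitClosed` [Prop. 4.9.1 (a)] BY NAME.**  The junction of the LH6 skeleton
v2: `StCharTS_of_organs … (hT) := stCharTS_of_quasiSplit_of_transferExists hT (QST_of_organs …)`.  Proof: as `stCharTS_of_quasiSplit`, with (T_v) obtained at `v` from
`hT` (its own canonical families; a non-split `v` has one place above it, ★ `PlacesOver.eq_of_smul_eq`), moved to the frame's families (`isLocalDeltaTransferExists_of_isCanonical_pair`)
and to the model (`isLocalDeltaTransferExists_model_of_formCongr`). [cite: Rogawski1990, §12.7 Lemma 12.7.3 & Cor. 12.7.4 p. 195; §4.9 Prop. 4.9.1 (a) p. 55; §14.4 pp. 234–237]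
[cite: LanglandsShelstad1987, §4.2] -/
theorem stCharTS_of_quasiSplit_of_transferExists (hT : LocalTransferExplicitNonsplitClosed)
    (hQST : ∀ (L : Type) [Field L] [NumberField L] [IsCMField L] (μ : HeckeCharacter L) (ξ : OneDimAutRepH L) (v : HeightOneSpectrum (𝓞 ↥(maximalRealSubfield L))),
      (∀ w : PlacesOver L v, IsCMField.complexConj L • w.1 = w.1) → μ.IsUnitary →
      (∀ x : Literature.NumberTheory.GaloisRepresentations.ideleGroup ↥(maximalRealSubfield L),
        μ (AdeleRing.ideleBaseChange (↥(maximalRealSubfield L)) L x) = quadraticHeckeCharCM L x) →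
      ∀ [MeasurableSpace ((UnitaryGroup.cmDatum L 2 (Matrix.of fun i j : Fin 2 => if i.val + j.val + 1 = 2 then (1 : L) else 0)).Local v × (UnitaryGroup.cmDatum L 1 (Matrix.of fun i j : Fin 1 => if i.val + j.val + 1 = 1 then (1 : L) else 0)).Local v)] [BorelSpace ((UnitaryGroup.cmDatum L 2 (Matrix.of fun i j : Fin 2 => if i.val + j.val + 1 = 2 then (1 : L) else 0)).Local v × (UnitaryGroup.cmDatum L 1 (Matrix.of fun i j : Fin 1 => if i.val + j.val + 1 = 1 then (1 : L) else 0)).Local v)] [MeasurableSpace ((UnitaryGroup.cmDatum L 3 (Matrix.of fun i j : Fin 3 => if i.val + j.val + 1 = 3 then (1 : L) else 0)).Local v)] [BorelSpace ((UnitaryGroup.cmDatum L 3 (Matrix.of fun i j : Fin 3 => if i.val + j.val + 1 = 3 then (1 : L) else 0)).Local v)]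
        (νHv : Measure ((UnitaryGroup.cmDatum L 2 (Matrix.of fun i j : Fin 2 => if i.val + j.val + 1 = 2 then (1 : L) else 0)).Local v × (UnitaryGroup.cmDatum L 1 (Matrix.of fun i j : Fin 1 => if i.val + j.val + 1 = 1 then (1 : L) else 0)).Local v)) (νQv : Measure ((UnitaryGroup.cmDatum L 3 (Matrix.of fun i j : Fin 3 => if i.val + j.val + 1 = 3 then (1 : L) else 0)).Local v))
        [νHv.IsHaarMeasure] [νHv.IsMulRightInvariant] [νQv.IsHaarMeasure] [νQv.IsMulRightInvariant],
      letI : ∀ a : (UnitaryGroup.cmDatum L 2 (Matrix.of fun i j : Fin 2 => if i.val + j.val + 1 = 2 then (1 : L) else 0)).Local v × (UnitaryGroup.cmDatum L 1 (Matrix.of fun i j : Fin 1 => if i.val + j.val + 1 = 1 then (1 : L) else 0)).Local v, MeasurableSpace (((UnitaryGroup.cmDatum L 2 (Matrix.of fun i j : Fin 2 => if i.val + j.val + 1 = 2 then (1 : L) else 0)).Local v × (UnitaryGroup.cmDatum L 1 (Matrix.of fun i j : Fin 1 => if i.val + j.val + 1 = 1 then (1 : L) else 0)).Local v) ⧸ Subgroup.centralizer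 ({a} : Set ((UnitaryGroup.cmDatum L 2 (Matrix.of fun i j : Fin 2 => if i.val + j.val + 1 = 2 then (1 : L) else 0)).Local v × (UnitaryGroup.cmDatum L 1 (Matrix.of fun i j : Fin 1 => if i.val + j.val + 1 = 1 then (1 : L) else 0)).Local v))) := fun _ => borel _
      haveI : ∀ a : (UnitaryGroup.cmDatum L 2 (Matrix.of fun i j : Fin 2 => if i.val + j.val + 1 = 2 then (1 : L) else 0)).Local v × (UnitaryGroup.cmDatum L 1 (Matrix.of fun i j : Fin 1 => if i.val + j.val + 1 = 1 then (1 : L) else 0)).Local v, BorelSpace (((UnitaryGroup.cmDatum L 2 (Matrix.of fun i j : Fin 2 => if i.val + j.val + 1 = 2 then (1 : L) else 0)).Local v × (UnitaryGroup.cmDatum L 1 (Matrix.of fun i j : Fin 1 => if i.val + j.val + 1 = 1 then (1 : L) else 0)).Local v) ⧸ Subgroup.centralizer ({a} : Set ((UnitaryGroup.cmDatum L 2 (Matrix.of fun i j : Fin 2 => if i.val + j.val + 1 = 2 then (1 : L) else 0)).Local v × (UnitaryGroup.cmDatum L 1 (Matrix.of fun i j : Fin 1 => if i.val + j.val + 1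 = 1 then (1 : L) else 0)).Local v))) := fun _ => ⟨rfl⟩
      letI : ∀ γ : (UnitaryGroup.cmDatum L 3 (Matrix.of fun i j : Fin 3 => if i.val + j.val + 1 = 3 then (1 : L) else 0)).Local v, MeasurableSpace (((UnitaryGroup.cmDatum L 3 (Matrix.of fun i j : Fin 3 => if i.val + j.val + 1 = 3 then (1 : L) else 0)).Local v) ⧸ Subgroup.centralizer ({γ} : Set ((UnitaryGroup.cmDatum L 3 (Matrix.of fun i j : Fin 3 => if i.val + j.val + 1 = 3 then (1 : L) else 0)).Local v))) := fun _ => borel _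
      haveI : ∀ γ : (UnitaryGroup.cmDatum L 3 (Matrix.of fun i j : Fin 3 => if i.val + j.val + 1 = 3 then (1 : L) else 0)).Local v, BorelSpace (((UnitaryGroup.cmDatum L 3 (Matrix.of fun i j : Fin 3 => if i.val + j.val + 1 = 3 then (1 : L) else 0)).Local v) ⧸ Subgroup.centralizer ({γ} : Set ((UnitaryGroup.cmDatum L 3 (Matrix.of fun i j : Fin 3 => if i.val + j.val + 1 = 3 then (1 : L) else 0)).Local v))) := fun _ => ⟨rfl⟩
      ∀ (mHv : OrbitalMeasureFamily ((UnitaryGroup.cmDatum L 2 (Matrix.of fun i j : Fin 2 => if i.val + j.val + 1 = 2 then (1 : L) else 0)).Local v × (UnitaryGroup.cmDatum L 1 (Matrix.of fun i j : Fin 1 => if i.val + j.val + 1 = 1 then (1 : L) else 0)).Local v)) (mQv : OrbitalMeasureFamily ((UnitaryGroup.cmDatum L 3 (Matrix.of fun i j : Fin 3 => if i.val + j.val + 1 = 3 then (1 : L) else 0)).Local v)),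
        mHv.IsCanonical (IsLocalGRegular L v) νHv →
        mQv.IsCanonical (fun γ => IsRegularElt (γ.val : GL (Fin 3) (UnitaryGroup.LocalRing L v))) νQv →
      IsLocalDeltaTransferExists L (Matrix.of fun i j : Fin 3 => if i.val + j.val + 1 = 3 then (1 : L) else 0) v ((finExplicitCollection L (Matrix.of fun i j : Fin 3 => if i.val + j.val + 1 = 3 then (1 : L) else 0) μ (finExplicitDelta_conj_left_all L (Matrix.of fun i j : Fin 3 => if i.val + j.val + 1 = 3 then (1 : L) else 0) μ) (finExplicitDelta_conj_right_all L (Matrix.of fun i j : Fin 3 => if i.val + j.val + 1 = 3 then (1 : L) else 0) μ)) v) mHv mQv IsLocSmooth IsLocSmooth →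
      ∀ [MeasurableSpace (Gqs L v ⧸ Subgroup.center (Gqs L v))] [BorelSpace (Gqs L v ⧸ Subgroup.center (Gqs L v))]
        (μZ : Measure (Gqs L v ⧸ Subgroup.center (Gqs L v))) [μZ.IsHaarMeasure],
      ∀ (π₁ πSt : IrrClass ((UnitaryGroup.cmDatum L 2 (Matrix.of fun i j : Fin 2 => if i.val + j.val + 1 = 2 then (1 : L) else 0)).Local v × (UnitaryGroup.cmDatum L 1 (Matrix.of fun i j : Fin 1 => if i.val + j.val + 1 = 1 then (1 : L) else 0)).Local v)),
        HLengthTwoLabels L v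
          (torusCharPair (conjLocal L (IsCMField.complexConj L) v) (cmLocalForm L 2 v) (cmLocalForm_eq_over L 2 v) 0
            ((torusLocalComponent L (IsCMField.complexConj L) v ξ.η).comp
                (quotConj (conjLocal L (IsCMField.complexConj L) v) (conjLocal_conjLocal_cm L v)) *
              halfModulusChar (UnitaryGroup.LocalRing L v))
            (torusLocalComponent L (IsCMField.complexConj L) v ξ.ψ))
          ((torusLocalComponent L (IsCMField.complexConj L) v ξ.ψ).comp (localDet (IsCMField.complexConj L) v (isUnit_antidiagOne_det L 1))) π₁ πSt →
        (∀ fH : (UnitaryGroup.cmDatum L 2 (Matrix.of fun i j : Fin 2 => if i.val + j.val + 1 = 2 then (1 : L) else 0)).Local v × (UnitaryGroup.cmDatum L 1 (Matrix.of fun i j : Fin 1 => if i.val + j.val + 1 = 1 then (1 : L) else 0)).Local v → ℂ, IsLocSmooth fH → π₁.smoothTrace νHv fH = charDist (ξ.xiLocalChar v) νHv fH) →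
      ∀ (π2 πn : IrrClass (Gqs L v)),
        KeysCaseTwoLabels L v (μ.semilocalComponent L v) (torusLocalComponent L (IsCMField.complexConj L) v ξ.η)
          (torusLocalComponent L (IsCMField.complexConj L) v ξ.ψ) π2 πn →
        ¬ πn.IsSquareIntegrable μZ →
        ∃ πs : IrrClass (Gqs L v), πs.IsSupercuspidal ∧ πs ≠ πn ∧
          ∀ (fH : (UnitaryGroup.cmDatum L 2 (Matrix.of fun i j : Fin 2 => if i.val + j.val + 1 = 2 then (1 : L) else 0)).Local v × (UnitaryGroup.cmDatum L 1 (Matrix.of fun i j : Fin 1 => if i.val + j.val + 1 = 1 then (1 : L) else 0)).Local v → ℂ) (φ : (UnitaryGroup.cmDatum L 3 (Matrix.of fun i j : Fin 3 => if i.val + j.val + 1 = 3 then (1 : L) else 0)).Local v → ℂ), IsLocSmooth fH → IsLocSmooth φ →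
            IsLocalDeltaTransfer L (Matrix.of fun i j : Fin 3 => if i.val + j.val + 1 = 3 then (1 : L) else 0) v ((finExplicitCollection L (Matrix.of fun i j : Fin 3 => if i.val + j.val + 1 = 3 then (1 : L) else 0) μ (finExplicitDelta_conj_left_all L (Matrix.of fun i j : Fin 3 => if i.val + j.val + 1 = 3 then (1 : L) else 0) μ) (finExplicitDelta_conj_right_all L (Matrix.of fun i j : Fin 3 => if i.val + j.val + 1 = 3 then (1 : L) else 0) μ)) v) mHv mQv fH φ →
            πSt.smoothTrace νHv fH = π2.smoothTrace νQv φ - πs.smoothTrace νQv φ) :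
  ∀ (L : Type) [Field L] [NumberField L] [IsCMField L] (H : Matrix (Fin 3) (Fin 3) L) (μ : HeckeCharacter L)
    [∀ v : HeightOneSpectrum (𝓞 ↥(maximalRealSubfield L)), MeasurableSpace ((UnitaryGroup.cmDatum L 2 (Matrix.of fun i j : Fin 2 => if i.val + j.val + 1 = 2 then (1 : L) else 0)).Local v × (UnitaryGroup.cmDatum L 1 (Matrix.of fun i j : Fin 1 => if i.val + j.val + 1 = 1 then (1 : L) else 0)).Local v)] [∀ v : HeightOneSpectrum (𝓞 ↥(maximalRealSubfield L)), BorelSpace ((UnitaryGroup.cmDatum L 2 (Matrix.of fun i j : Fin 2 => if i.val + j.val + 1 = 2 then (1 : L) else 0)).Local v × (UnitaryGroup.cmDatum L 1 (Matrix.of fun i j : Fin 1 => if i.val + j.val + 1 = 1 then (1 : L) else 0)).Local v)]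
    [∀ v : HeightOneSpectrum (𝓞 ↥(maximalRealSubfield L)), MeasurableSpace ((UnitaryGroup.cmDatum L 3 H).Local v)] [∀ v : HeightOneSpectrum (𝓞 ↥(maximalRealSubfield L)), BorelSpace ((UnitaryGroup.cmDatum L 3 H).Local v)]
    (νH : ∀ v : HeightOneSpectrum (𝓞 ↥(maximalRealSubfield L)), Measure ((UnitaryGroup.cmDatum L 2 (Matrix.of fun i j : Fin 2 => if i.val + j.val + 1 = 2 then (1 : L) else 0)).Local v × (UnitaryGroup.cmDatum L 1 (Matrix.of fun i j : Fin 1 => if i.val + j.val + 1 = 1 then (1 : L) else 0)).Local v)) (νG : ∀ v : HeightOneSpectrum (𝓞 ↥(maximalRealSubfield L)), Measure ((UnitaryGroup.cmDatum L 3 H).Local v))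
    [∀ v, (νH v).IsHaarMeasure] [∀ v, (νH v).IsMulRightInvariant] [∀ v, (νG v).IsHaarMeasure] [∀ v, (νG v).IsMulRightInvariant]
    (hμu : μ.IsUnitary)
    (_hμω : ∀ x : Literature.NumberTheory.GaloisRepresentations.ideleGroup ↥(maximalRealSubfield L),
      μ (AdeleRing.ideleBaseChange (↥(maximalRealSubfield L)) L x) = quadraticHeckeCharCM L x)
    (hherm : (H.map (cmConjRingHom L))ᵀ = H)
    (hanis : ∀ x : Fin 3 → L, Literature.AlgebraicGeometry.ShimuraVarieties.hermForm (cmConjRingHom L) H x x = 0 → x = 0),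
    letI : ∀ (v : HeightOneSpectrum (𝓞 ↥(maximalRealSubfield L))) (a : (UnitaryGroup.cmDatum L 2 (Matrix.of fun i j : Fin 2 => if i.val + j.val + 1 = 2 then (1 : L) else 0)).Local v × (UnitaryGroup.cmDatum L 1 (Matrix.of fun i j : Fin 1 => if i.val + j.val + 1 = 1 then (1 : L) else 0)).Local v), MeasurableSpace (((UnitaryGroup.cmDatum L 2 (Matrix.of fun i j : Fin 2 => if i.val + j.val + 1 = 2 then (1 : L) else 0)).Local v × (UnitaryGroup.cmDatum L 1 (Matrix.of fun i j : Fin 1 => if i.val + j.val + 1 = 1 then (1 : L) else 0)).Local v) ⧸ Subgroup.centralizer ({a} : Set ((UnitaryGroup.cmDatum L 2 (Matrix.of fun i j : Fin 2 => if i.val + j.val + 1 = 2 then (1 : L) else 0)).Local v × (UnitaryGroup.cmDatum L 1 (Matrix.of fun i j : Fin 1 => if i.val + j.val + 1 = 1 then (1 : L) else 0)).Local v))) := fun _ _ => borel _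
    haveI : ∀ (v : HeightOneSpectrum (𝓞 ↥(maximalRealSubfield L))) (a : (UnitaryGroup.cmDatum L 2 (Matrix.of fun i j : Fin 2 => if i.val + j.val + 1 = 2 then (1 : L) else 0)).Local v × (UnitaryGroup.cmDatum L 1 (Matrix.of fun i j : Fin 1 => if i.val + j.val + 1 = 1 then (1 : L) else 0)).Local v), BorelSpace (((UnitaryGroup.cmDatum L 2 (Matrix.of fun i j : Fin 2 => if i.val + j.val + 1 = 2 then (1 : L) else 0)).Local v × (UnitaryGroup.cmDatum L 1 (Matrix.of fun i j : Fin 1 => if i.val + j.val + 1 = 1 then (1 : L) else 0)).Local v) ⧸ Subgroup.centralizer ({a} : Set ((UnitaryGroup.cmDatum L 2 (Matrix.of fun i j : Fin 2 => if i.val + j.val + 1 = 2 then (1 : L) else 0)).Local v × (UnitaryGroup.cmDatum L 1 (Matrix.of fun i j : Fin 1 => if i.val + j.val + 1 = 1 then (1 : L) else 0)).Local v))) := fun _ _ => ⟨rfl⟩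
    letI : ∀ (v : HeightOneSpectrum (𝓞 ↥(maximalRealSubfield L))) (γ : (UnitaryGroup.cmDatum L 3 H).Local v), MeasurableSpace (((UnitaryGroup.cmDatum L 3 H).Local v) ⧸ Subgroup.centralizer ({γ} : Set ((UnitaryGroup.cmDatum L 3 H).Local v))) := fun _ _ => borel _
    haveI : ∀ (v : HeightOneSpectrum (𝓞 ↥(maximalRealSubfield L))) (γ : (UnitaryGroup.cmDatum L 3 H).Local v), BorelSpace (((UnitaryGroup.cmDatum L 3 H).Local v) ⧸ Subgroup.centralizer ({γ} : Set ((UnitaryGroup.cmDatum L 3 H).Local v))) := fun _ _ => ⟨rfl⟩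
    ∀ (mH : ∀ v : HeightOneSpectrum (𝓞 ↥(maximalRealSubfield L)), OrbitalMeasureFamily ((UnitaryGroup.cmDatum L 2 (Matrix.of fun i j : Fin 2 => if i.val + j.val + 1 = 2 then (1 : L) else 0)).Local v × (UnitaryGroup.cmDatum L 1 (Matrix.of fun i j : Fin 1 => if i.val + j.val + 1 = 1 then (1 : L) else 0)).Local v)) (mG : ∀ v : HeightOneSpectrum (𝓞 ↥(maximalRealSubfield L)), OrbitalMeasureFamily ((UnitaryGroup.cmDatum L 3 H).Local v)),
      (∀ v : HeightOneSpectrum (𝓞 ↥(maximalRealSubfield L)), (mH v).IsCanonical (IsLocalGRegular L v) (νH v) ∧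
          (mG v).IsCanonical (fun γ => IsRegularElt (γ.val : GL (Fin 3) (UnitaryGroup.LocalRing L v))) (νG v)) →
      ∀ (ξ : OneDimAutRepH L) (v : HeightOneSpectrum (𝓞 ↥(maximalRealSubfield L))), (∀ w : PlacesOver L v, IsCMField.complexConj L • w.1 = w.1) →
      ∀ (T : GL (Fin 3) (UnitaryGroup.LocalRing L v)) (a : UnitaryGroup.LocalRing L v) (ha : IsUnit a)
        (h : formCongr (conjLocal L (IsCMField.complexConj L) v) T (H.map (algebraMap L (UnitaryGroup.LocalRing L v))) =
          a • (Matrix.of fun i j : Fin 3 => if i.val + j.val + 1 = 3 then (1 : L) else 0).map (algebraMap L (UnitaryGroup.LocalRing L v))),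
      ∀ [MeasurableSpace (Gqs L v ⧸ Subgroup.center (Gqs L v))] [BorelSpace (Gqs L v ⧸ Subgroup.center (Gqs L v))]
        (μZ : Measure (Gqs L v ⧸ Subgroup.center (Gqs L v))) [μZ.IsHaarMeasure],
      ∀ (π₁ πSt : IrrClass ((UnitaryGroup.cmDatum L 2 (Matrix.of fun i j : Fin 2 => if i.val + j.val + 1 = 2 then (1 : L) else 0)).Local v × (UnitaryGroup.cmDatum L 1 (Matrix.of fun i j : Fin 1 => if i.val + j.val + 1 = 1 then (1 : L) else 0)).Local v)),
        HLengthTwoLabels L v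
          (torusCharPair (conjLocal L (IsCMField.complexConj L) v) (cmLocalForm L 2 v) (cmLocalForm_eq_over L 2 v) 0
            ((torusLocalComponent L (IsCMField.complexConj L) v ξ.η).comp
                (quotConj (conjLocal L (IsCMField.complexConj L) v) (conjLocal_conjLocal_cm L v)) *
              halfModulusChar (UnitaryGroup.LocalRing L v))
            (torusLocalComponent L (IsCMField.complexConj L) v ξ.ψ))
          ((torusLocalComponent L (IsCMField.complexConj L) v ξ.ψ).comp (localDet (IsCMField.complexConj L) v (isUnit_antidiagOne_det L 1))) π₁ πSt →
        (∀ fH : (UnitaryGroup.cmDatum L 2 (Matrix.of fun i j : Fin 2 => if i.val + j.val + 1 = 2 then (1 : L) else 0)).Local v × (UnitaryGroup.cmDatum L 1 (Matrix.of fun i j : Fin 1 => if i.val + j.val + 1 = 1 then (1 : L) else 0)).Local v → ℂ, IsLocSmooth fH → π₁.smoothTrace (νH v) fH = charDist (ξ.xiLocalChar v) (νH v) fH) →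
      ∀ (π2 πn : IrrClass (Gqs L v)),
        KeysCaseTwoLabels L v (μ.semilocalComponent L v) (torusLocalComponent L (IsCMField.complexConj L) v ξ.η)
          (torusLocalComponent L (IsCMField.complexConj L) v ξ.ψ) π2 πn →
        ¬ πn.IsSquareIntegrable μZ →
        ∃ πs : IrrClass ((UnitaryGroup.cmDatum L 3 H).Local v), πs.IsSupercuspidal ∧ πs ≠ IrrClass.comap (cmDatumLocalCongr L v T ha h).symm πn ∧
          ∀ (fH : (UnitaryGroup.cmDatum L 2 (Matrix.of fun i j : Fin 2 => if i.val + j.val + 1 = 2 then (1 : L) else 0)).Local v × (UnitaryGroup.cmDatum L 1 (Matrix.of fun i j : Fin 1 => if i.val + j.val + 1 = 1 then (1 : L) else 0)).Local v → ℂ) (f : (UnitaryGroup.cmDatum L 3 H).Local v → ℂ), IsLocSmooth fH → IsLocSmooth f →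
            IsLocalDeltaTransfer L H v ((finExplicitCollection L H μ (finExplicitDelta_conj_left_all L H μ) (finExplicitDelta_conj_right_all L H μ)) v) (mH v) (mG v) fH f →
            πSt.smoothTrace (νH v) fH =
              (if ∃ z : UnitaryGroup.LocalRing L v, IsUnit z ∧ a = z * conjLocal L (IsCMField.complexConj L) v z then (1 : ℂ) else -1) *
                ((IrrClass.comap (cmDatumLocalCongr L v T ha h).symm π2).smoothTrace (νG v) f - πs.smoothTrace (νG v) f) := by
  intro L _ _ _ H μ _ _ _ _ νH νG _ _ _ _ hμu hμω hherm hanis mH mG hcan ξ v hns T a ha h _ _ μZ _ π₁ πSt hHL hπ₁ π2 πn hK hL2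
  -- (0) the statement's quotient σ-algebras at `v`, re-installed as local instances
  letI : ∀ a' : (UnitaryGroup.cmDatum L 2 (Matrix.of fun i j : Fin 2 => if i.val + j.val + 1 = 2 then (1 : L) else 0)).Local v × (UnitaryGroup.cmDatum L 1 (Matrix.of fun i j : Fin 1 => if i.val + j.val + 1 = 1 then (1 : L) else 0)).Local v, MeasurableSpace (((UnitaryGroup.cmDatum L 2 (Matrix.of fun i j : Fin 2 => if i.val + j.val + 1 = 2 then (1 : L) else 0)).Local v × (UnitaryGroup.cmDatum L 1 (Matrix.of fun i j : Fin 1 => if i.val + j.val + 1 = 1 then (1 : L) else 0)).Local v) ⧸ Subgroup.centralizer ({a'} : Set ((UnitaryGroup.cmDatum L 2 (Matrix.of fun i j : Fin 2 => if i.val + j.val + 1 = 2 then (1 : L) else 0)).Local v × (UnitaryGroup.cmDatum L 1 (Matrix.of fun i j : Fin 1 => if i.val + j.val + 1 = 1 then (1 : L) else 0)).Local v))) := fun _ => borel _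
  haveI : ∀ a' : (UnitaryGroup.cmDatum L 2 (Matrix.of fun i j : Fin 2 => if i.val + j.val + 1 = 2 then (1 : L) else 0)).Local v × (UnitaryGroup.cmDatum L 1 (Matrix.of fun i j : Fin 1 => if i.val + j.val + 1 = 1 then (1 : L) else 0)).Local v, BorelSpace (((UnitaryGroup.cmDatum L 2 (Matrix.of fun i j : Fin 2 => if i.val + j.val + 1 = 2 then (1 : L) else 0)).Local v × (UnitaryGroup.cmDatum L 1 (Matrix.of fun i j : Fin 1 => if i.val + j.val + 1 = 1 then (1 : L) else 0)).Local v) ⧸ Subgroup.centralizer ({a'} : Set ((UnitaryGroup.cmDatum L 2 (Matrix.of fun i j : Fin 2 => if i.val + j.val + 1 = 2 then (1 : L) else 0)).Local v × (UnitaryGroup.cmDatum L 1 (Matrix.of fun i j : Fin 1 => if i.val + j.val + 1 = 1 then (1 : L) else 0)).Local v))) := fun _ => ⟨rfl⟩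
  letI : ∀ γ : (UnitaryGroup.cmDatum L 3 H).Local v, MeasurableSpace (((UnitaryGroup.cmDatum L 3 H).Local v) ⧸ Subgroup.centralizer ({γ} : Set ((UnitaryGroup.cmDatum L 3 H).Local v))) := fun _ => borel _
  haveI : ∀ γ : (UnitaryGroup.cmDatum L 3 H).Local v, BorelSpace (((UnitaryGroup.cmDatum L 3 H).Local v) ⧸ Subgroup.centralizer ({γ} : Set ((UnitaryGroup.cmDatum L 3 H).Local v))) := fun _ => ⟨rfl⟩
  -- (1) Borel structures on the model and the transported Haar measure
  letI iMQ : MeasurableSpace ((UnitaryGroup.cmDatum L 3 (Matrix.of fun i j : Fin 3 => if i.val + j.val + 1 = 3 then (1 : L) else 0)).Local v) := borel _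
  haveI iBQ : BorelSpace ((UnitaryGroup.cmDatum L 3 (Matrix.of fun i j : Fin 3 => if i.val + j.val + 1 = 3 then (1 : L) else 0)).Local v) := ⟨rfl⟩
  letI : ∀ γ : (UnitaryGroup.cmDatum L 3 (Matrix.of fun i j : Fin 3 => if i.val + j.val + 1 = 3 then (1 : L) else 0)).Local v, MeasurableSpace (((UnitaryGroup.cmDatum L 3 (Matrix.of fun i j : Fin 3 => if i.val + j.val + 1 = 3 then (1 : L) else 0)).Local v) ⧸ Subgroup.centralizer ({γ} : Set ((UnitaryGroup.cmDatum L 3 (Matrix.of fun i j : Fin 3 => if i.val + j.val + 1 = 3 then (1 : L) else 0)).Local v))) := fun _ => borel _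
  haveI : ∀ γ : (UnitaryGroup.cmDatum L 3 (Matrix.of fun i j : Fin 3 => if i.val + j.val + 1 = 3 then (1 : L) else 0)).Local v, BorelSpace (((UnitaryGroup.cmDatum L 3 (Matrix.of fun i j : Fin 3 => if i.val + j.val + 1 = 3 then (1 : L) else 0)).Local v) ⧸ Subgroup.centralizer ({γ} : Set ((UnitaryGroup.cmDatum L 3 (Matrix.of fun i j : Fin 3 => if i.val + j.val + 1 = 3 then (1 : L) else 0)).Local v))) := fun _ => ⟨rfl⟩
  haveI : ((νG v).map (cmDatumLocalCongr L v T ha h).symm).IsMulRightInvariant :=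
    Literature.MeasureTheory.Group.isMulRightInvariant_map_mulEquiv_of_isMulRightInvariant (cmDatumLocalCongr L v T ha h).symm.toMulEquiv
      (cmDatumLocalCongr L v T ha h).symm.continuous.measurable (νG v)
  -- (2) frame facts
  obtain ⟨w⟩ : Nonempty (PlacesOver L v) := inferInstance
  have hw : IsCMField.complexConj L • w.1 = w.1 := hns w
  have hdet : H.det ≠ 0 := Godement.det_ne_zero_of_anisotropic L H hanis
  have haσ : conjLocal L (IsCMField.complexConj L) v a = a :=
    conjLocal_eq_self_of_formCongr_eq_smul_antidiag L (N := 3) (by norm_num) hherm v T h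
  have hcl' : ∀ γ : (UnitaryGroup.cmDatum L 3 (Matrix.of fun i j : Fin 3 => if i.val + j.val + 1 = 3 then (1 : L) else 0)).Local v,
      Corresponds (UnitaryGroup.conjLocal L (IsCMField.complexConj L) v) ((UnitaryGroup.adelicForm L 3 H).map (UnitaryGroup.adeleToLocal L v))
        ((UnitaryGroup.adelicForm L 3 (Matrix.of fun i j : Fin 3 => if i.val + j.val + 1 = 3 then (1 : L) else 0)).map (UnitaryGroup.adeleToLocal L v))
        ((cmDatumLocalCongr L v T ha h) γ) γ :=
    fun γ => corresponds_comm.1 (corresponds_cmDatumLocalCongr L v T ha h γ)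
  have hmQ : (((mG v).transport (cmDatumLocalCongr L v T ha h).symm.toMulEquiv (cmDatumLocalCongr L v T ha h).symm.continuous (cmDatumLocalCongr L v T ha h).continuous)).IsCanonical
      (fun γ => IsRegularElt (γ.val : GL (Fin 3) (UnitaryGroup.LocalRing L v))) ((νG v).map (cmDatumLocalCongr L v T ha h).symm) :=
    transport_isCanonical_isRegularElt L H v (cmDatumLocalCongr L v T ha h).symm (fun γ => by simpa only [ContinuousMulEquiv.symm_symm] using hcl' γ)
      (νG v) ((νG v).map (cmDatumLocalCongr L v T ha h).symm) rfl (hcan v).2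
  -- (T) transfer existence: from the closer's row at `v` (one place above `v`), moved to the frame's canonical families, transported to the model
  have hsub : Subsingleton (PlacesOver L v) :=
    ⟨fun w₁ w₂ => (PlacesOver.eq_of_smul_eq (IsCMField.complexConj L) (IsCMField.complexConj_ne_one L) w₂ (hns w₂) w₁)⟩
  obtain ⟨mH', mG', ⟨hcH', hcG'⟩, hex⟩ := hT L H μ νH νG hμu hμω hherm hanis v hsub
  have hTv : IsLocalDeltaTransferExists L H v ((finExplicitCollection L H μ (finExplicitDelta_conj_left_all L H μ) (finExplicitDelta_conj_right_all L H μ)) v) (mH v) (mG v) IsLocSmooth IsLocSmooth :=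
    isLocalDeltaTransferExists_of_isCanonical_pair L H v (νH v) (νG v) _ (hcan v).1 hcH' (hcan v).2 hcG' _ _ hex
  have hexQ := isLocalDeltaTransferExists_model_of_formCongr L H μ v w hw hherm hdet T ha haσ h (mH v) (mG v) hTv
  -- (3) the quasi-split statement at `v` for the transported data
  obtain ⟨πs', hsc, hne, hid⟩ := hQST L μ ξ v hns hμu hμω (νH v) ((νG v).map (cmDatumLocalCongr L v T ha h).symm) (mH v) ((mG v).transport (cmDatumLocalCongr L v T ha h).symm.toMulEquiv (cmDatumLocalCongr L v T ha h).symm.continuous (cmDatumLocalCongr L v T ha h).continuous) (hcan v).1 hmQ hexQ μZ π₁ πSt hHL hπ₁ π2 πn hK hL2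
  -- (4) the sign and the model-side identity in «TR»'s currency
  have hχχ : ((if ∃ z : UnitaryGroup.LocalRing L v, IsUnit z ∧ a = z * UnitaryGroup.conjLocal L (IsCMField.complexConj L) v z then (1 : ℤ) else -1 : ℤ) : ℂ) * ((if ∃ z : UnitaryGroup.LocalRing L v, IsUnit z ∧ a = z * UnitaryGroup.conjLocal L (IsCMField.complexConj L) v z then (1 : ℤ) else -1 : ℤ) : ℂ) = 1 := by
    split_ifs <;> norm_num
  have hχsgn : ((if ∃ z : UnitaryGroup.LocalRing L v, IsUnit z ∧ a = z * UnitaryGroup.conjLocal L (IsCMField.complexConj L) v z then (1 : ℤ) else -1 : ℤ) : ℂ) = (if ∃ z : UnitaryGroup.LocalRing L v, IsUnit z ∧ a = z * conjLocal L (IsCMField.complexConj L) v z then (1 : ℂ) else -1) := by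
    split_ifs <;> norm_num
  haveI : NonarchimedeanGroup ((UnitaryGroup.cmDatum L 3 (Matrix.of fun i j : Fin 3 => if i.val + j.val + 1 = 3 then (1 : L) else 0)).Local v) :=
    nonarchimedeanGroup_unitaryGroupOfForm_local (E := L) (c := IsCMField.complexConj L) (N := 3) (v := v)
      (J' := (UnitaryGroup.adelicForm L 3 (Matrix.of fun i j : Fin 3 => if i.val + j.val + 1 = 3 then (1 : L) else 0)).map (UnitaryGroup.adeleToLocal L v))
  have hlin : ∀ (π : IrrClass ((UnitaryGroup.cmDatum L 3 (Matrix.of fun i j : Fin 3 => if i.val + j.val + 1 = 3 then (1 : L) else 0)).Local v)), π.IsAdmissible → ∀ (φ : (UnitaryGroup.cmDatum L 3 (Matrix.of fun i j : Fin 3 => if i.val + j.val + 1 = 3 then (1 : L) else 0)).Local v → ℂ), IsLocSmooth φ →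
      π.smoothTrace ((νG v).map (cmDatumLocalCongr L v T ha h).symm) (((if ∃ z : UnitaryGroup.LocalRing L v, IsUnit z ∧ a = z * UnitaryGroup.conjLocal L (IsCMField.complexConj L) v z then (1 : ℤ) else -1 : ℤ) : ℂ) • φ) = ((if ∃ z : UnitaryGroup.LocalRing L v, IsUnit z ∧ a = z * UnitaryGroup.conjLocal L (IsCMField.complexConj L) v z then (1 : ℤ) else -1 : ℤ) : ℂ) * π.smoothTrace ((νG v).map (cmDatumLocalCongr L v T ha h).symm) φ := by
    intro π hπ φ hφ
    induction π using IrrClass.ind with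
    | h r => exact r.ρ.smoothTrace_smul_of_mem _ ((IrrClass.isAdmissible_mk r).1 hπ) _ ⟨hφ.1, hφ.2⟩
  refine F0P3cStCharTSTransport.steinbergCompanion_of_model (cmDatumLocalCongr L v T ha h) (νG v) (νH v)
    (IsLocalDeltaTransfer L H v ((finExplicitCollection L H μ (finExplicitDelta_conj_left_all L H μ) (finExplicitDelta_conj_right_all L H μ)) v) (mH v) (mG v)) πSt π2 πn (if ∃ z : UnitaryGroup.LocalRing L v, IsUnit z ∧ a = z * conjLocal L (IsCMField.complexConj L) v z then (1 : ℂ) else -1)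
    (F0P3cStCharTSTransport.isAdmissible_pi2_of_keysLabels L μ ξ v hK) ⟨πs', hsc, hne, ?_⟩
  intro fH φ hfH hφ hm
  have hφe : (φ ∘ (cmDatumLocalCongr L v T ha h).symm) ∘ (cmDatumLocalCongr L v T ha h) = φ := by
    funext q
    simp only [Function.comp_apply, ContinuousMulEquiv.symm_apply_apply]
  have hm₁ := (isLocalDeltaTransfer_iff_of_formCongr L H μ v w hw hherm hdet T ha haσ h (mH v) (mG v) fH (φ ∘ (cmDatumLocalCongr L v T ha h).symm)).1 hm
  rw [hφe] at hm₁
  have hm₂ : IsLocalDeltaTransfer L (Matrix.of fun i j : Fin 3 => if i.val + j.val + 1 = 3 then (1 : L) else 0) v ((finExplicitCollection L (Matrix.of fun i j : Fin 3 => if i.val + j.val + 1 = 3 then (1 : L) else 0) μ (finExplicitDelta_conj_left_all L (Matrix.of fun i j : Fin 3 => if i.val + j.val + 1 = 3 then (1 : L) else 0) μ) (finExplicitDelta_conj_right_all L (Matrix.of fun i j : Fin 3 => if i.val + j.val + 1 = 3 then (1 : L) else 0) μ)) v) (mH v) ((mG v).transport (cmDatumLocalCongr L v T ha h).symm.toMulEquiv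 (cmDatumLocalCongr L v T ha h).symm.continuous (cmDatumLocalCongr L v T ha h).continuous) fH (((if ∃ z : UnitaryGroup.LocalRing L v, IsUnit z ∧ a = z * UnitaryGroup.conjLocal L (IsCMField.complexConj L) v z then (1 : ℤ) else -1 : ℤ) : ℂ) • φ) := by
    have h₂ := IsDeltaTransferRel.smul_fun hm₁ ((if ∃ z : UnitaryGroup.LocalRing L v, IsUnit z ∧ a = z * UnitaryGroup.conjLocal L (IsCMField.complexConj L) v z then (1 : ℤ) else -1 : ℤ) : ℂ)
    rwa [smul_smul, hχχ, one_smul] at h₂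
  have hχφ : IsLocSmooth (((if ∃ z : UnitaryGroup.LocalRing L v, IsUnit z ∧ a = z * UnitaryGroup.conjLocal L (IsCMField.complexConj L) v z then (1 : ℤ) else -1 : ℤ) : ℂ) • φ) := ⟨hφ.1.comp fun z => ((if ∃ z : UnitaryGroup.LocalRing L v, IsUnit z ∧ a = z * UnitaryGroup.conjLocal L (IsCMField.complexConj L) v z then (1 : ℤ) else -1 : ℤ) : ℂ) * z, hφ.2.mono (Function.support_const_smul_subset _ φ)⟩
  rw [hid fH _ hfH hχφ hm₂, hlin π2 (F0P3cStCharTSTransport.isAdmissible_pi2_of_keysLabels L μ ξ v hK) φ hφ,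
    hlin πs' (F0P3cStCharTSTransport.isAdmissible_of_isSupercuspidal πs' hsc) φ hφ, ← hχsgn]
  ring

end Summit.HodgeConjecture.HodgeConjecture.Cruxes.H413.F0P3cStCharTSOfQuasiSplit
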